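import Literature.MathematicalPhysics.QuantumLattice.DressedClusterEnergyBound
import Literature.MathematicalPhysics.QuantumLattice.HubbardModel
import HarnessLib

/-!
# The plaquette-dressed Slater bound on the even square torus

Topic `MathematicalPhysics/QuantumLattice`, family `hubbard`; the instance of
`DressedClusterEnergyBound.lean` for the Hubbard model on the discrete torus `(ℤ/2Mℤ)²`
(`fermionTorusGraph 2 (M * 2)`) tiled by the `M²` disjoint `2 × 2` plaquettes
`{2c₁, 2c₁+1} × {2c₂, 2c₂+1}`, `c ∈ (ℤ/M)²`:

* cell coordinates: `cellSite c a = (2cᵢ + aᵢ)ᵢ` identifies `(ℤ/M)² × {0,1}²` with the torus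
  (`cellEquiv`), the plaquette charts `cellEmb c : {0,1}² ↪ torus` have pairwise disjoint images,
  and the LINK charts `linkEmb c e : {0,1} × {0,1}² ↪ torus` cover the plaquette pair
  `(c, c + e)` (`e` a unit vector of `(ℤ/M)²`, `M ≥ 2`);
* `adj_cellSite_iff` — nearest-neighbour adjacency of the torus in cell coordinates: either an
  edge of the plaquette 4-cycle (`plaquetteGraph`, same cell) or one of the two "middle" bonds
  between the plaquettes `c` and `c ± e` (`linkGraph e`);
* `hamiltonian_eq_sum_cells_add_sum_links` — **cluster decomposition of the Hubbard Hamiltonian**: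
  `H_{2M} = Σ_c Γ(cellEmb c) H_plaq + Σ_{c,e} Γ(linkEmb c e) T_e` with `H_plaq` the Hubbard
  Hamiltonian of the 4-cycle (hopping + on-site repulsion of one plaquette) and `T_e` the pure
  hopping operator (`U = 0`) of the two bonds joining plaquette `c` to plaquette `c + e`;
* `groundEnergyAt_le_dressed` — **the bound**: for every orthogonal projection `P` on the
  one-particle space of the torus with `tr P = N` and every particle-number conserving unitary
  `u` of the plaquette Fock space (`uᴴ u = 1`, `[N̂, u] = 0`; one `u_c` per plaquette is allowed),
  `E_{(ℤ/2M)²}(t, U; N) ≤ Re [ Σ_c Σ_{s,t} (u_cᴴ H_plaq u_c)_{st} ρ_P^{cell c}(s,t)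
     + Σ_{c,e} Σ_{s,t} (V_{c,e}ᴴ T_e V_{c,e})_{st} ρ_P^{link c,e}(s,t) ]`,
  `V_{c,e} = Γ(inl) u_c · Γ(inr) u_{c+e}`, with the explicit window reduced density matrices
  `ρ_P^φ = slaterRDM (P|_φ)` of `SlaterWindowReducedDensityMatrix.lean`.

With `P` the spin-density-wave projection of `HartreeFockSDWTorus.lean` and one optimised `u` this
is the "plaquette local-unitary-cluster" upper bound on the half-filled Hubbard torus; combined with
`ThermodynamicLimit.energyDensity2D_le` (`e(ρ) ≤ E_{L×L}/L² + 16|t|/L`) it bounds the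
thermodynamic-limit energy density from above by a finite, exactly evaluable expression.
Sources: Bach–Lieb–Solovej 1994 (variational principle for quasi-free states)
[BachLiebSolovej1994]; Bratteli–Robinson II §5.2.2 [BratteliRobinsonII1997]; the tiling is
elementary. Everything is proved; definitions have bodies; no named facts.
-/

noncomputable section

namespace Literature.MathematicalPhysics.QuantumLattice

open Matrix Finset HubbardWave0 Literature.Probability.LatticeModels
open scoped ComplexOrder Function

namespace PlaquetteLUC

variable {M : ℕ}

/-! ### §1. Cell coordinates on the torus `(ℤ/2M)²` -/

/-- The site `(2cᵢ + aᵢ)ᵢ` of the torus `(ℤ/2M)²` with plaquette index `c ∈ (ℤ/M)²` and offset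
`a ∈ {0,1}²` (Mathlib's `finProdFinEquiv (cᵢ, aᵢ) = aᵢ + 2cᵢ`). [folklore] -/
def cellSite (c : Fin 2 → Fin M) (a : FermionTorus 2 2) : FermionTorus 2 (M * 2) :=
  toLex fun i => finProdFinEquiv (c i, ofLex a i)

/-- The value of a cell coordinate: `(cellSite c a)ᵢ = aᵢ + 2 cᵢ`. [folklore] -/
theorem val_cellSite (c : Fin 2 → Fin M) (a : FermionTorus 2 2) (i : Fin 2) :
    ((ofLex (cellSite c a) i : Fin (M * 2)) : ℕ) = (ofLex a i : ℕ) + 2 * (c i : ℕ) := by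
  simp [cellSite]

/-- **Cell coordinates**: `(ℤ/M)² × {0,1}² ≃ (ℤ/2M)²`, `(c, a) ↦ (2cᵢ + aᵢ)ᵢ`. [folklore] -/
def cellEquiv : (Fin 2 → Fin M) × FermionTorus 2 2 ≃ FermionTorus 2 (M * 2) where
  toFun p := cellSite p.1 p.2
  invFun x := (fun i => (finProdFinEquiv.symm (ofLex x i)).1, toLex fun i => (finProdFinEquiv.symm (ofLex x i)).2)
  left_inv p := by
    obtain ⟨c, a⟩ := p
    refine Prod.ext (funext fun i => ?_) ?_
    · simp [cellSite]
    · change toLex (fun i => (finProdFinEquiv.symm (ofLex (cellSite c a) i)).2) = a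
      have h : (fun i => (finProdFinEquiv.symm (ofLex (cellSite c a) i)).2) = ofLex a :=
        funext fun i => by simp [cellSite]
      rw [h, toLex_ofLex]
  right_inv x := by
    change toLex (fun i => finProdFinEquiv ((finProdFinEquiv.symm (ofLex x i)).1,
      ofLex (toLex fun i => (finProdFinEquiv.symm (ofLex x i)).2) i)) = x
    simp only [ofLex_toLex, Prod.mk.eta, Equiv.apply_symm_apply]
    exact toLex_ofLex x

/-- `cellEquiv (c, a) = cellSite c a`. [folklore] -/
@[simp] theorem cellEquiv_apply (c : Fin 2 → Fin M) (a : FermionTorus 2 2) :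
    cellEquiv (c, a) = cellSite c a := rfl

/-- `cellSite` is jointly injective. [folklore] -/
theorem cellSite_inj {c c' : Fin 2 → Fin M} {a b : FermionTorus 2 2} :
    cellSite c a = cellSite c' b ↔ c = c' ∧ a = b := by
  rw [← cellEquiv_apply, ← cellEquiv_apply, cellEquiv.apply_eq_iff_eq, Prod.mk.injEq]

/-- The chart of the plaquette `c`: `a ↦ (2cᵢ + aᵢ)ᵢ`. [folklore] -/
def cellEmb (c : Fin 2 → Fin M) : FermionTorus 2 2 ↪ FermionTorus 2 (M * 2) :=
  ⟨cellSite c, fun _ _ h => (cellSite_inj.1 h).2⟩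

/-- `cellEmb c a = cellSite c a`. [folklore] -/
@[simp] theorem cellEmb_apply (c : Fin 2 → Fin M) (a : FermionTorus 2 2) : cellEmb c a = cellSite c a := rfl

/-- Distinct plaquettes are disjoint. [folklore] -/
theorem disjoint_cellEmb {c c' : Fin 2 → Fin M} (h : c ≠ c') :
    Disjoint ((univ : Finset (FermionTorus 2 2)).map (cellEmb c)) (univ.map (cellEmb c')) := by
  rw [Finset.disjoint_left]
  rintro x hx hx'
  obtain ⟨a, -, rfl⟩ := Finset.mem_map.1 hx
  obtain ⟨b, -, hb⟩ := Finset.mem_map.1 hx'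
  exact h (cellSite_inj.1 hb).1.symm

variable [NeZero M]

/-- The neighbouring plaquette index `c + e`. [folklore] -/
def shiftCell (c : Fin 2 → Fin M) (e : Fin 2) : Fin 2 → Fin M := c + Pi.single e 1

/-- For `M ≥ 2` a plaquette differs from its neighbours. [folklore] -/
theorem shiftCell_ne (hM : 2 ≤ M) (c : Fin 2 → Fin M) (e : Fin 2) : shiftCell c e ≠ c := by
  intro h
  have h1 := congrFun h e
  rw [shiftCell, Pi.add_apply, Pi.single_eq_same] at h1
  have h2 := congrArg Fin.val h1
  rw [Fin.val_add, Fin.val_one', Nat.mod_eq_of_lt (by omega : 1 < M)] at h2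
  have hc := (c e).isLt
  rcases Nat.lt_or_ge ((c e : ℕ) + 1) M with hlt | hge
  · rw [Nat.mod_eq_of_lt hlt] at h2; omega
  · have heq : (c e : ℕ) + 1 = M := by omega
    rw [heq, Nat.mod_self] at h2; omega

/-- The chart of the link window made of the plaquettes `c` (first copy) and `c + e` (second
copy): `(i, a) ↦ cellSite (c + i e) a`. [folklore] -/
def linkSite (c : Fin 2 → Fin M) (e : Fin 2) (p : Fin 2 ×ₗ FermionTorus 2 2) : FermionTorus 2 (M * 2) :=
  cellSite (if (ofLex p).1 = 0 then c else shiftCell c e) (ofLex p).2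

/-- `linkSite` is injective for `M ≥ 2`. [folklore] -/
theorem linkSite_injective (hM : 2 ≤ M) (c : Fin 2 → Fin M) (e : Fin 2) :
    Function.Injective (linkSite c e) := by
  intro p q h
  rw [linkSite, linkSite, cellSite_inj] at h
  obtain ⟨h1, h2⟩ := h
  have hi : (ofLex p).1 = (ofLex q).1 := by
    by_contra hne
    rcases Fin.eq_zero_or_eq_succ (ofLex p).1 with hp | ⟨k, hk⟩ <;>
      rcases Fin.eq_zero_or_eq_succ (ofLex q).1 with hq | ⟨l, hl⟩
    · exact hne (hp.trans hq.symm)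
    · rw [hp, hl, if_pos rfl, if_neg (Fin.succ_ne_zero l)] at h1
      exact shiftCell_ne hM c e h1.symm
    · rw [hk, hq, if_neg (Fin.succ_ne_zero k), if_pos rfl] at h1
      exact shiftCell_ne hM c e h1
    · apply hne; rw [hk, hl, Fin.eq_zero k, Fin.eq_zero l]
  exact ofLex.injective (Prod.ext hi h2)

/-- The link chart as an embedding (`M ≥ 2`). [folklore] -/
def linkEmb (hM : 2 ≤ M) (c : Fin 2 → Fin M) (e : Fin 2) : Fin 2 ×ₗ FermionTorus 2 2 ↪ FermionTorus 2 (M * 2) :=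
  ⟨linkSite c e, linkSite_injective hM c e⟩

/-- `linkEmb` unfolded. [folklore] -/
@[simp] theorem linkEmb_apply (hM : 2 ≤ M) (c : Fin 2 → Fin M) (e : Fin 2) (p : Fin 2 ×ₗ FermionTorus 2 2) :
    linkEmb hM c e p = cellSite (if (ofLex p).1 = 0 then c else shiftCell c e) (ofLex p).2 := rfl

/-- The first plaquette of a link window. [folklore] -/
def inlCell : FermionTorus 2 2 ↪ Fin 2 ×ₗ FermionTorus 2 2 :=
  ⟨fun a => toLex (0, a), fun a b h => by simpa using congrArg (fun p => (ofLex p).2) h⟩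

/-- The second plaquette of a link window. [folklore] -/
def inrCell : FermionTorus 2 2 ↪ Fin 2 ×ₗ FermionTorus 2 2 :=
  ⟨fun a => toLex (1, a), fun a b h => by simpa using congrArg (fun p => (ofLex p).2) h⟩

/-- `inlCell a = (0, a)`. [folklore] -/
@[simp] theorem inlCell_apply (a : FermionTorus 2 2) : inlCell a = toLex (0, a) := rfl

/-- `inrCell a = (1, a)`. [folklore] -/
@[simp] theorem inrCell_apply (a : FermionTorus 2 2) : inrCell a = toLex (1, a) := rfl

/-- The first copy of a link window is the plaquette `c`. [folklore] -/
theorem inlCell_trans_linkEmb (hM : 2 ≤ M) (c : Fin 2 → Fin M) (e : Fin 2) :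
    inlCell.trans (linkEmb hM c e) = cellEmb c := by
  ext a; simp [Function.Embedding.trans_apply]

/-- The second copy of a link window is the plaquette `c + e`. [folklore] -/
theorem inrCell_trans_linkEmb (hM : 2 ≤ M) (c : Fin 2 → Fin M) (e : Fin 2) :
    inrCell.trans (linkEmb hM c e) = cellEmb (shiftCell c e) := by
  ext a; simp [Function.Embedding.trans_apply]

/-- The two copies cover the link window. [folklore] -/
theorem mem_range_inlCell_or_inrCell (p : Fin 2 ×ₗ FermionTorus 2 2) :
    p ∈ Set.range inlCell ∨ p ∈ Set.range inrCell := by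
  rcases Fin.eq_zero_or_eq_succ (ofLex p).1 with h | ⟨k, hk⟩
  · left
    refine ⟨(ofLex p).2, ?_⟩
    change toLex (0, (ofLex p).2) = p
    rw [← h, Prod.mk.eta, toLex_ofLex]
  · right
    refine ⟨(ofLex p).2, ?_⟩
    change toLex (1, (ofLex p).2) = p
    rw [Fin.eq_zero k] at hk
    rw [show (1 : Fin 2) = Fin.succ 0 from rfl, ← hk, Prod.mk.eta, toLex_ofLex]

/-! ### §2. Torus adjacency in cell coordinates -/

/-- One coordinate of the torus `ℤ/2M` in cell form `u = a + 2c`: `v = u + 1 (mod 2M)` iff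
`(a, b) = (0, 1)` inside the cell `c' = c`, or `(a, b) = (1, 0)` across to the next cell `c' = c + 1`.
[folklore] -/
theorem cast_cell_eq_add_one_iff (hM : 2 ≤ M) (c c' : Fin M) (a b : Fin 2) :
    ((((finProdFinEquiv (c', b) : Fin (M * 2)) : ℕ) : ZMod (M * 2)) =
        (((finProdFinEquiv (c, a) : Fin (M * 2)) : ℕ) : ZMod (M * 2)) + 1) ↔
      (a = 0 ∧ b = 1 ∧ c' = c) ∨ (a = 1 ∧ b = 0 ∧ c' = c + 1) := by
  have ha := a.isLt; have hb := b.isLt; have hc := c.isLt; have hc' := c'.isLt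
  have hcast : (((finProdFinEquiv (c, a) : Fin (M * 2)) : ℕ) : ZMod (M * 2)) + 1 =
      ((((finProdFinEquiv (c, a) : Fin (M * 2)) : ℕ) + 1 : ℕ) : ZMod (M * 2)) := by push_cast; rfl
  rw [hcast, ZMod.natCast_eq_natCast_iff', Nat.mod_eq_of_lt (finProdFinEquiv (c', b)).isLt]
  simp only [finProdFinEquiv_apply_val]
  have hstep : c' = c + 1 ↔ ((c' : ℕ) = c + 1 ∨ ((c : ℕ) + 1 = M ∧ (c' : ℕ) = 0)) := by
    rw [Fin.ext_iff, Fin.val_add, Fin.val_one', Nat.mod_eq_of_lt (by omega : 1 < M)]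
    rcases Nat.lt_or_ge ((c : ℕ) + 1) M with h | h
    · rw [Nat.mod_eq_of_lt h]; omega
    · rw [show (c : ℕ) + 1 = M by omega, Nat.mod_self]; omega
  have hmod : ((a : ℕ) + 2 * c + 1) % (M * 2) =
      if (a : ℕ) + 2 * c + 1 < M * 2 then (a : ℕ) + 2 * c + 1 else 0 := by
    split_ifs with h
    · exact Nat.mod_eq_of_lt h
    · rw [show (a : ℕ) + 2 * c + 1 = M * 2 by omega, Nat.mod_self]
  rw [hmod, hstep, Fin.ext_iff, Fin.ext_iff, Fin.ext_iff, Fin.ext_iff, Fin.ext_iff]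
  simp only [Fin.val_zero, Fin.val_one]
  split_ifs with h <;> omega

omit [NeZero M] in
/-- The statistical-mechanics coordinates of a cell site. [folklore] -/
theorem toTorusSite_cellSite (c : Fin 2 → Fin M) (a : FermionTorus 2 2) (i : Fin 2) :
    FermionTorus.toTorusSite (cellSite c a) i =
      (((finProdFinEquiv (c i, ofLex a i) : Fin (M * 2)) : ℕ) : ZMod (M * 2)) := rfl

omit [NeZero M] in
/-- Equality of one torus coordinate in cell form. [folklore] -/
theorem cast_cell_eq_iff (c c' : Fin M) (a b : Fin 2) :
    ((((finProdFinEquiv (c', b) : Fin (M * 2)) : ℕ) : ZMod (M * 2)) =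
        (((finProdFinEquiv (c, a) : Fin (M * 2)) : ℕ) : ZMod (M * 2))) ↔ c' = c ∧ b = a := by
  rw [ZMod.natCast_eq_natCast_iff', Nat.mod_eq_of_lt (finProdFinEquiv (c', b)).isLt,
    Nat.mod_eq_of_lt (finProdFinEquiv (c, a)).isLt, ← Fin.ext_iff, finProdFinEquiv.apply_eq_iff_eq,
    Prod.mk.injEq]

/-- A unit step of the torus in cell coordinates: `cellSite c' b = cellSite c a + eᵢ` iff the two
sites agree off the `i`-th coordinate and the `i`-th coordinate steps inside the cell
(`aᵢ = 0, bᵢ = 1`) or into the next cell (`aᵢ = 1, bᵢ = 0, c'ᵢ = cᵢ + 1`). [folklore] -/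
theorem toTorusSite_cellSite_eq_add_single_iff (hM : 2 ≤ M) (c c' : Fin 2 → Fin M)
    (a b : FermionTorus 2 2) (i : Fin 2) :
    FermionTorus.toTorusSite (cellSite c' b) = FermionTorus.toTorusSite (cellSite c a) + Pi.single i 1 ↔
      (∀ j, j ≠ i → c' j = c j ∧ ofLex b j = ofLex a j) ∧
        ((ofLex a i = 0 ∧ ofLex b i = 1 ∧ c' i = c i) ∨ (ofLex a i = 1 ∧ ofLex b i = 0 ∧ c' i = c i + 1)) := by
  rw [funext_iff]
  constructor
  · intro h
    refine ⟨fun j hj => ?_, ?_⟩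
    · have hj' := h j
      rw [Pi.add_apply, Pi.single_eq_of_ne hj, add_zero, toTorusSite_cellSite, toTorusSite_cellSite,
        cast_cell_eq_iff] at hj'
      exact hj'
    · have hi := h i
      rw [Pi.add_apply, Pi.single_eq_same, toTorusSite_cellSite, toTorusSite_cellSite,
        cast_cell_eq_add_one_iff hM] at hi
      exact hi
  · rintro ⟨hoff, hi⟩ j
    by_cases hj : j = i
    · subst hj
      rw [Pi.add_apply, Pi.single_eq_same, toTorusSite_cellSite, toTorusSite_cellSite,
        cast_cell_eq_add_one_iff hM]
      exact hi
    · rw [Pi.add_apply, Pi.single_eq_of_ne hj, add_zero, toTorusSite_cellSite, toTorusSite_cellSite,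
        cast_cell_eq_iff]
      exact hoff j hj

/-- **Nearest-neighbour adjacency of the torus `(ℤ/2M)²` in cell coordinates** (`M ≥ 2`): the two
sites agree off one coordinate `i`, along which one of them is the unit step of the other, inside a
plaquette or across to the neighbouring plaquette. [folklore] -/
theorem adj_cellSite_iff (hM : 2 ≤ M) (c c' : Fin 2 → Fin M) (a b : FermionTorus 2 2) :
    (fermionTorusGraph 2 (M * 2)).Adj (cellSite c a) (cellSite c' b) ↔
      ∃ i : Fin 2, (∀ j, j ≠ i → c' j = c j ∧ ofLex b j = ofLex a j) ∧
        (((ofLex a i = 0 ∧ ofLex b i = 1 ∧ c' i = c i) ∨ (ofLex a i = 1 ∧ ofLex b i = 0 ∧ c' i = c i + 1)) ∨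
         ((ofLex b i = 0 ∧ ofLex a i = 1 ∧ c i = c' i) ∨ (ofLex b i = 1 ∧ ofLex a i = 0 ∧ c i = c' i + 1))) := by
  haveI : Fact (1 < M * 2) := ⟨by omega⟩
  rw [fermionTorusGraph_adj, torusGraph_adj_iff]
  constructor
  · rintro ⟨-, ⟨i, hi⟩ | ⟨i, hi⟩⟩
    · obtain ⟨hoff, hst⟩ := (toTorusSite_cellSite_eq_add_single_iff hM c c' a b i).1 hi
      exact ⟨i, hoff, Or.inl hst⟩
    · obtain ⟨hoff, hst⟩ := (toTorusSite_cellSite_eq_add_single_iff hM c' c b a i).1 hi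
      exact ⟨i, fun j hj => ⟨((hoff j hj).1).symm, ((hoff j hj).2).symm⟩, Or.inr hst⟩
  · rintro ⟨i, hoff, hst | hst⟩
    · have h := (toTorusSite_cellSite_eq_add_single_iff hM c c' a b i).2 ⟨hoff, hst⟩
      refine ⟨fun heq => ?_, Or.inl ⟨i, h⟩⟩
      have := congrFun h i
      rw [heq, Pi.add_apply, Pi.single_eq_same, left_eq_add] at this
      exact one_ne_zero this
    · have h := (toTorusSite_cellSite_eq_add_single_iff hM c' c b a i).2
        ⟨fun j hj => ⟨((hoff j hj).1).symm, ((hoff j hj).2).symm⟩, hst⟩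
      refine ⟨fun heq => ?_, Or.inr ⟨i, h⟩⟩
      have := congrFun h i
      rw [← heq, Pi.add_apply, Pi.single_eq_same, left_eq_add] at this
      exact one_ne_zero this

/-! ### §3. The plaquette graph and the link graphs -/

/-- **The plaquette 4-cycle** on the offsets `{0,1}²`: two distinct offsets are adjacent iff they
agree in one coordinate (hence differ in exactly the other). [folklore] -/
def plaquetteGraph : SimpleGraph (FermionTorus 2 2) where
  Adj a b := a ≠ b ∧ ∃ i : Fin 2, ∀ j, j ≠ i → ofLex b j = ofLex a j
  symm := ⟨fun _ _ h => ⟨h.1.symm, h.2.imp fun _ hi j hj => (hi j hj).symm⟩⟩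
  loopless := ⟨fun _ h => h.1 rfl⟩

/-- Adjacency in the plaquette graph, unfolded. [folklore] -/
theorem plaquetteGraph_adj (a b : FermionTorus 2 2) :
    plaquetteGraph.Adj a b ↔ a ≠ b ∧ ∃ i : Fin 2, ∀ j, j ≠ i → ofLex b j = ofLex a j := Iff.rfl

/-- Adjacency in the plaquette graph is decidable. [folklore] -/
instance : DecidableRel plaquetteGraph.Adj := fun a b =>
  decidable_of_iff _ (plaquetteGraph_adj a b).symm

/-- The "middle bond" condition between an offset `a` of a plaquette and an offset `b` of the NEXT
plaquette in direction `e`: `a_e = 1`, `b_e = 0`, equal transverse coordinates. [folklore] -/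
def LinkMid (e : Fin 2) (a b : FermionTorus 2 2) : Prop :=
  ofLex a e = 1 ∧ ofLex b e = 0 ∧ ∀ j, j ≠ e → ofLex b j = ofLex a j

/-- The middle-bond condition is decidable. [folklore] -/
instance (e : Fin 2) (a b : FermionTorus 2 2) : Decidable (LinkMid e a b) :=
  inferInstanceAs (Decidable (ofLex a e = 1 ∧ ofLex b e = 0 ∧ ∀ j, j ≠ e → ofLex b j = ofLex a j))

/-- **The link graph** of direction `e` on the window `{0,1} × {0,1}²` (copy `0` = plaquette `c`,
copy `1` = plaquette `c + e`): the two bonds joining the `a_e = 1` side of copy `0` to the `b_e = 0`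
side of copy `1`. [folklore] -/
def linkGraph (e : Fin 2) : SimpleGraph (Fin 2 ×ₗ FermionTorus 2 2) where
  Adj p q := ((ofLex p).1 = 0 ∧ (ofLex q).1 = 1 ∧ LinkMid e (ofLex p).2 (ofLex q).2) ∨
    ((ofLex p).1 = 1 ∧ (ofLex q).1 = 0 ∧ LinkMid e (ofLex q).2 (ofLex p).2)
  symm := ⟨fun _ _ h => h.elim (fun h => Or.inr ⟨h.2.1, h.1, h.2.2⟩) fun h => Or.inl ⟨h.2.1, h.1, h.2.2⟩⟩
  loopless := ⟨fun _ h => by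
    rcases h with ⟨h0, h1, -⟩ | ⟨h1, h0, -⟩
    · exact absurd (h0.symm.trans h1) (by decide)
    · exact absurd (h0.symm.trans h1) (by decide)⟩

/-- Adjacency in the link graph, unfolded. [folklore] -/
theorem linkGraph_adj (e : Fin 2) (p q : Fin 2 ×ₗ FermionTorus 2 2) :
    (linkGraph e).Adj p q ↔ ((ofLex p).1 = 0 ∧ (ofLex q).1 = 1 ∧ LinkMid e (ofLex p).2 (ofLex q).2) ∨
      ((ofLex p).1 = 1 ∧ (ofLex q).1 = 0 ∧ LinkMid e (ofLex q).2 (ofLex p).2) := Iff.rfl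

/-- Adjacency in the link graph is decidable. [folklore] -/
instance (e : Fin 2) : DecidableRel (linkGraph e).Adj := fun p q =>
  decidable_of_iff _ (linkGraph_adj e p q).symm

/-- Two middle-bond conditions in different roles are incompatible. [folklore] -/
theorem not_linkMid_of_linkMid {e e' : Fin 2} {a b : FermionTorus 2 2} (h : LinkMid e a b) :
    ¬LinkMid e' b a := by
  rintro ⟨h1, h2, h3⟩
  obtain ⟨k1, k2, k3⟩ := h
  by_cases hee : e' = e
  · subst hee
    rw [k1] at h2
    exact absurd h2 (by decide)
  · have := k3 e' hee
    rw [h1, h2] at this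
    exact absurd this (by decide)

/-- The middle-bond conditions of the two directions are incompatible. [folklore] -/
theorem not_linkMid_of_linkMid_of_ne {e e' : Fin 2} (hee : e ≠ e') {a b : FermionTorus 2 2}
    (h : LinkMid e a b) : ¬LinkMid e' a b := by
  rintro ⟨h1, h2, -⟩
  obtain ⟨-, -, k3⟩ := h
  have := k3 e' (Ne.symm hee)
  rw [h1, h2] at this
  exact absurd this (by decide)

/-- Torus adjacency in cell coordinates, regrouped: an edge of the plaquette (same cell), or a
middle bond to the next cell `c + e`, or a middle bond from the previous cell (`c = c' + e`).
[folklore] -/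
theorem adj_cellSite_iff' (hM : 2 ≤ M) (c c' : Fin 2 → Fin M) (a b : FermionTorus 2 2) :
    (fermionTorusGraph 2 (M * 2)).Adj (cellSite c a) (cellSite c' b) ↔
      (c' = c ∧ plaquetteGraph.Adj a b) ∨
        ∃ e : Fin 2, (c' = shiftCell c e ∧ LinkMid e a b) ∨ (c = shiftCell c' e ∧ LinkMid e b a) := by
  rw [adj_cellSite_iff hM]
  constructor
  · rintro ⟨i, hoff, (⟨ha, hb, hc⟩ | ⟨ha, hb, hc⟩) | (⟨hb, ha, hc⟩ | ⟨hb, ha, hc⟩)⟩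
    · refine Or.inl ⟨funext fun j => ?_, (plaquetteGraph_adj a b).2 ⟨?_, ⟨i, fun j hj => (hoff j hj).2⟩⟩⟩
      · by_cases hj : j = i
        · rw [hj, hc]
        · exact (hoff j hj).1
      · intro hab; rw [hab, hb] at ha; exact absurd ha (by decide)
    · refine Or.inr ⟨i, Or.inl ⟨funext fun j => ?_, ha, hb, fun j hj => (hoff j hj).2⟩⟩
      by_cases hj : j = i
      · rw [hj, hc, shiftCell, Pi.add_apply, Pi.single_eq_same]
      · rw [(hoff j hj).1, shiftCell, Pi.add_apply, Pi.single_eq_of_ne hj, add_zero]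
    · refine Or.inl ⟨funext fun j => ?_, (plaquetteGraph_adj a b).2 ⟨?_, ⟨i, fun j hj => (hoff j hj).2⟩⟩⟩
      · by_cases hj : j = i
        · rw [hj, hc]
        · exact (hoff j hj).1
      · intro hab; rw [hab, hb] at ha; exact absurd ha (by decide)
    · refine Or.inr ⟨i, Or.inr ⟨funext fun j => ?_, hb, ha, fun j hj => ((hoff j hj).2).symm⟩⟩
      by_cases hj : j = i
      · rw [hj, hc, shiftCell, Pi.add_apply, Pi.single_eq_same]
      · rw [← (hoff j hj).1, shiftCell, Pi.add_apply, Pi.single_eq_of_ne hj, add_zero]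
  · rintro (⟨rfl, hadj⟩ | ⟨e, ⟨rfl, ha, hb, hoff⟩ | ⟨rfl, hb, ha, hoff⟩⟩)
    · obtain ⟨hne, i, hoff⟩ := (plaquetteGraph_adj a b).1 hadj
      refine ⟨i, fun j hj => ⟨rfl, hoff j hj⟩, ?_⟩
      have hi : ofLex a i ≠ ofLex b i := by
        intro h
        apply hne
        refine (toLex_ofLex a).symm.trans (((congrArg toLex (funext fun j => ?_))).trans (toLex_ofLex b))
        by_cases hj : j = i
        · rw [hj]; exact h
        · exact (hoff j hj).symm
      rcases Fin.eq_zero_or_eq_succ (ofLex a i) with h0 | ⟨k, hk⟩ <;>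
        rcases Fin.eq_zero_or_eq_succ (ofLex b i) with h0' | ⟨k', hk'⟩
      · exact absurd (h0.trans h0'.symm) hi
      · rw [Fin.eq_zero k'] at hk'
        exact Or.inl (Or.inl ⟨h0, hk', rfl⟩)
      · rw [Fin.eq_zero k] at hk
        exact Or.inr (Or.inl ⟨h0', hk, rfl⟩)
      · rw [Fin.eq_zero k] at hk; rw [Fin.eq_zero k'] at hk'
        exact absurd (hk.trans hk'.symm) hi
    · refine ⟨e, fun j hj => ⟨?_, hoff j hj⟩, Or.inl (Or.inr ⟨ha, hb, ?_⟩)⟩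
      · rw [shiftCell, Pi.add_apply, Pi.single_eq_of_ne hj, add_zero]
      · rw [shiftCell, Pi.add_apply, Pi.single_eq_same]
    · refine ⟨e, fun j hj => ⟨?_, (hoff j hj).symm⟩, Or.inr (Or.inr ⟨hb, ha, ?_⟩)⟩
      · rw [shiftCell, Pi.add_apply, Pi.single_eq_of_ne hj, add_zero]
      · rw [shiftCell, Pi.add_apply, Pi.single_eq_same]

/-! ### §4. The cluster decomposition of the torus Hamiltonian -/

section Sums

variable {β : Type*} [AddCommMonoid β]

omit [NeZero M] in
/-- Summing over the torus in cell coordinates. [folklore] -/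
theorem sum_cellSite (f : FermionTorus 2 (M * 2) → β) :
    ∑ x, f x = ∑ c : Fin 2 → Fin M, ∑ a : FermionTorus 2 2, f (cellSite c a) := by
  rw [← (cellEquiv (M := M)).sum_comp, Fintype.sum_prod_type]
  rfl

/-- `[P ∨ Q] x = [P] x + [Q] x` for exclusive `P`, `Q`. [folklore] -/
theorem ite_or_eq_add {P Q : Prop} [Decidable P] [Decidable Q] (h : P → ¬Q) (x : β) :
    (if P ∨ Q then x else 0) = (if P then x else 0) + (if Q then x else 0) := by
  by_cases hp : P
  · simp [hp, h hp]
  · simp [hp]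

/-- `[∃ e ∈ {0,1}, R e] x = [R 0] x + [R 1] x` for exclusive `R 0`, `R 1`. [folklore] -/
theorem ite_exists_fin_two_eq_add {R : Fin 2 → Prop} [DecidablePred R] (h : R 0 → ¬R 1) (x : β) :
    (if ∃ e, R e then x else 0) = ∑ e : Fin 2, (if R e then x else 0) := by
  rw [Fin.sum_univ_two, ← ite_or_eq_add h]
  congr 1
  exact propext ⟨fun ⟨e, he⟩ => by fin_cases e <;> simp_all, fun h => h.elim (fun h => ⟨0, h⟩) fun h => ⟨1, h⟩⟩

/-- **The indicator of torus adjacency splits over plaquette edges and link bonds** (pointwise form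
of the tiling; the alternatives are mutually exclusive for `M ≥ 2`). [folklore] -/
theorem ite_adj_cellSite_eq (hM : 2 ≤ M) (c c' : Fin 2 → Fin M) (a b : FermionTorus 2 2) (x : β) :
    (if (fermionTorusGraph 2 (M * 2)).Adj (cellSite c a) (cellSite c' b) then x else 0) =
      (if c' = c ∧ plaquetteGraph.Adj a b then x else 0) +
        ∑ e : Fin 2, ((if c' = shiftCell c e ∧ LinkMid e a b then x else 0) +
          (if c = shiftCell c' e ∧ LinkMid e b a then x else 0)) := by
  have hiff := adj_cellSite_iff' hM c c' a b
  rw [show (if (fermionTorusGraph 2 (M * 2)).Adj (cellSite c a) (cellSite c' b) then x else 0) =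
      if (c' = c ∧ plaquetteGraph.Adj a b) ∨
        ∃ e : Fin 2, (c' = shiftCell c e ∧ LinkMid e a b) ∨ (c = shiftCell c' e ∧ LinkMid e b a) then x else 0
      from by simp only [hiff]]
  rw [ite_or_eq_add]
  · congr 1
    rw [ite_exists_fin_two_eq_add]
    · refine Finset.sum_congr rfl fun e _ => ite_or_eq_add (fun h h' => ?_) x
      exact not_linkMid_of_linkMid (e' := e) h.2 h'.2
    · rintro (h | h) (h' | h')
      · exact not_linkMid_of_linkMid_of_ne (by decide) h.2 h'.2
      · exact not_linkMid_of_linkMid (e' := 1) h.2 h'.2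
      · exact not_linkMid_of_linkMid (e' := 0) h'.2 h.2
      · exact not_linkMid_of_linkMid_of_ne (by decide) h.2 h'.2
  · rintro ⟨rfl, -⟩ ⟨e, ⟨h, -⟩ | ⟨h, -⟩⟩
    · exact shiftCell_ne hM c' e h.symm
    · exact shiftCell_ne hM c' e h.symm

/-- The previous plaquette index `c - e`. [folklore] -/
theorem eq_shiftCell_iff (c c' : Fin 2 → Fin M) (e : Fin 2) :
    c = shiftCell c' e ↔ c' = c - Pi.single e 1 := by
  rw [shiftCell, eq_sub_iff_add_eq, eq_comm]

/-- `(c - e) + e = c`. [folklore] -/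
theorem shiftCell_sub (c : Fin 2 → Fin M) (e : Fin 2) : shiftCell (c - Pi.single e 1) e = c := by
  rw [shiftCell, sub_add_cancel]

/-- Reordering a triple sum (innermost index first). [folklore] -/
theorem sum_sum_sum_comm {α₁ α₂ α₃ : Type*} [Fintype α₁] [Fintype α₂] [Fintype α₃] (f : α₁ → α₂ → α₃ → β) :
    ∑ x, ∑ y, ∑ z, f x y z = ∑ z, ∑ x, ∑ y, f x y z := by
  calc ∑ x, ∑ y, ∑ z, f x y z = ∑ x, ∑ z, ∑ y, f x y z :=
        Finset.sum_congr rfl fun x _ => Finset.sum_comm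
    _ = ∑ z, ∑ x, ∑ y, f x y z := Finset.sum_comm

/-- The bonds starting at a fixed site, in cell coordinates: intra-plaquette edges, bonds to the
next plaquette `c + e`, bonds to the previous plaquette `c - e`. [folklore] -/
theorem sum_ite_adj_cellSite_eq (hM : 2 ≤ M) (X : FermionTorus 2 (M * 2) → FermionTorus 2 (M * 2) → β)
    (c : Fin 2 → Fin M) (a : FermionTorus 2 2) :
    (∑ y, if (fermionTorusGraph 2 (M * 2)).Adj (cellSite c a) y then X (cellSite c a) y else 0) =
      (∑ b : FermionTorus 2 2, if plaquetteGraph.Adj a b then X (cellSite c a) (cellSite c b) else 0) +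
        ∑ e : Fin 2, ((∑ b : FermionTorus 2 2,
            if LinkMid e a b then X (cellSite c a) (cellSite (shiftCell c e) b) else 0) +
          ∑ b : FermionTorus 2 2,
            if LinkMid e b a then X (cellSite c a) (cellSite (c - Pi.single e 1) b) else 0) := by
  rw [sum_cellSite]
  simp_rw [ite_adj_cellSite_eq hM]
  simp only [Finset.sum_add_distrib]
  -- the three kinds of terms
  have hQ : (∑ c' : Fin 2 → Fin M, ∑ b : FermionTorus 2 2,
      if c' = c ∧ plaquetteGraph.Adj a b then X (cellSite c a) (cellSite c' b) else 0) =
      ∑ b : FermionTorus 2 2, if plaquetteGraph.Adj a b then X (cellSite c a) (cellSite c b) else 0 := by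
    rw [Finset.sum_comm]
    refine Finset.sum_congr rfl fun b _ => ?_
    simp only [ite_and]
    rw [Finset.sum_ite_eq' univ c, if_pos (mem_univ _)]
  have hR : (∑ c' : Fin 2 → Fin M, ∑ b : FermionTorus 2 2, ∑ e : Fin 2,
      if c' = shiftCell c e ∧ LinkMid e a b then X (cellSite c a) (cellSite c' b) else 0) =
      ∑ e : Fin 2, ∑ b : FermionTorus 2 2, if LinkMid e a b then X (cellSite c a) (cellSite (shiftCell c e) b) else 0 := by
    rw [sum_sum_sum_comm]
    refine Finset.sum_congr rfl fun e _ => ?_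
    rw [Finset.sum_comm]
    refine Finset.sum_congr rfl fun b _ => ?_
    simp only [ite_and]
    rw [Finset.sum_ite_eq' univ (shiftCell c e), if_pos (mem_univ _)]
  have hS : (∑ c' : Fin 2 → Fin M, ∑ b : FermionTorus 2 2, ∑ e : Fin 2,
      if c = shiftCell c' e ∧ LinkMid e b a then X (cellSite c a) (cellSite c' b) else 0) =
      ∑ e : Fin 2, ∑ b : FermionTorus 2 2, if LinkMid e b a then X (cellSite c a) (cellSite (c - Pi.single e 1) b) else 0 := by
    rw [sum_sum_sum_comm]
    refine Finset.sum_congr rfl fun e _ => ?_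
    rw [Finset.sum_comm]
    refine Finset.sum_congr rfl fun b _ => ?_
    simp only [eq_shiftCell_iff, ite_and]
    rw [Finset.sum_ite_eq' univ (c - Pi.single e 1), if_pos (mem_univ _)]
  rw [hQ, hR, hS, ← Finset.sum_add_distrib]

/-- **Tiling of the torus bonds**: a sum over the ordered nearest-neighbour pairs of `(ℤ/2M)²` is the
sum over the ordered edges of the `M²` plaquettes plus, for every plaquette `c` and direction `e`,
the two middle bonds to the plaquette `c + e` in both orientations. [folklore] -/
theorem sum_ite_adj_eq (hM : 2 ≤ M) (X : FermionTorus 2 (M * 2) → FermionTorus 2 (M * 2) → β) :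
    ∑ x, ∑ y, (if (fermionTorusGraph 2 (M * 2)).Adj x y then X x y else 0) =
      ∑ c : Fin 2 → Fin M, ∑ a : FermionTorus 2 2, ∑ b : FermionTorus 2 2,
          (if plaquetteGraph.Adj a b then X (cellSite c a) (cellSite c b) else 0) +
        ∑ c : Fin 2 → Fin M, ∑ e : Fin 2,
          ((∑ a : FermionTorus 2 2, ∑ b : FermionTorus 2 2,
              if LinkMid e a b then X (cellSite c a) (cellSite (shiftCell c e) b) else 0) +
            ∑ a : FermionTorus 2 2, ∑ b : FermionTorus 2 2,
              if LinkMid e b a then X (cellSite (shiftCell c e) a) (cellSite c b) else 0) := by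
  rw [sum_cellSite]
  simp_rw [sum_ite_adj_cellSite_eq hM X]
  simp only [Finset.sum_add_distrib]
  congr 1
  -- links: `Σ_c Σ_a Σ_e (A + B)` has become `Σ_c Σ_a Σ_e A + Σ_c Σ_a Σ_e B`; likewise on the right
  congr 1
  · refine Finset.sum_congr rfl fun c _ => ?_
    rw [Finset.sum_comm]
  · -- reindex the plaquette sum `c ↦ c + e` in the `B` terms
    rw [sum_sum_sum_comm]
    conv_rhs => rw [Finset.sum_comm]
    refine Finset.sum_congr rfl fun e _ => ?_
    rw [← Equiv.sum_comp (Equiv.addRight (Pi.single e (1 : Fin M)))]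
    refine Finset.sum_congr rfl fun c _ => ?_
    simp only [Equiv.coe_addRight, add_sub_cancel_right]
    rfl

/-- Sums over the link window `{0,1} × {0,1}²` against the link graph: only the two middle bonds,
in both orientations, contribute. [folklore] -/
theorem sum_ite_linkGraph_eq (e : Fin 2) (Y : Fin 2 ×ₗ FermionTorus 2 2 → Fin 2 ×ₗ FermionTorus 2 2 → β) :
    ∑ p, ∑ q, (if (linkGraph e).Adj p q then Y p q else 0) =
      (∑ a : FermionTorus 2 2, ∑ b : FermionTorus 2 2,
          if LinkMid e a b then Y (toLex (0, a)) (toLex (1, b)) else 0) +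
        ∑ a : FermionTorus 2 2, ∑ b : FermionTorus 2 2,
          if LinkMid e b a then Y (toLex (1, a)) (toLex (0, b)) else 0 := by
  have hsum : ∀ g : Fin 2 ×ₗ FermionTorus 2 2 → β,
      ∑ p, g p = ∑ i : Fin 2, ∑ a : FermionTorus 2 2, g (toLex (i, a)) := by
    intro g
    rw [← (toLex : Fin 2 × FermionTorus 2 2 ≃ Fin 2 ×ₗ FermionTorus 2 2).sum_comp, Fintype.sum_prod_type]
  rw [hsum]
  have hinner : ∀ i a, (∑ q, if (linkGraph e).Adj (toLex (i, a)) q then Y (toLex (i, a)) q else 0) =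
      ∑ j : Fin 2, ∑ b : FermionTorus 2 2,
        if (linkGraph e).Adj (toLex (i, a)) (toLex (j, b)) then Y (toLex (i, a)) (toLex (j, b)) else 0 :=
    fun i a => hsum _
  simp_rw [hinner]
  simp only [linkGraph_adj, ofLex_toLex, Fin.sum_univ_two, Fin.isValue]
  simp

end Sums

/-- `Γ(φ)` applied to a Hubbard Hamiltonian: hopping along the image bonds and on-site repulsion on
the image sites. [folklore] -/
theorem fermionEmbed_hamiltonian {Λ₀ Λ : Type*} [LinearOrder Λ₀] [Fintype Λ₀] [LinearOrder Λ] [Fintype Λ]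
    (G₀ : SimpleGraph Λ₀) [DecidableRel G₀.Adj] (φ : Λ₀ ↪ Λ) (t U : ℝ) :
    fermionEmbed φ (hamiltonian G₀ t U) =
      -(t : ℂ) • (∑ a : Λ₀, ∑ b : Λ₀, ∑ σ : Fin 2,
          if G₀.Adj a b then creation (orb (φ a) σ) * annihilation (orb (φ b) σ) else 0) +
        (U : ℂ) • ∑ a : Λ₀, numberOp (φ a) 0 * numberOp (φ a) 1 := by
  rw [hamiltonian, fermionEmbed_add, fermionEmbed_smul, fermionEmbed_smul, fermionEmbed_sum, fermionEmbed_sum]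
  congr 2
  · refine Finset.sum_congr rfl fun a _ => ?_
    rw [fermionEmbed_sum]
    refine Finset.sum_congr rfl fun b _ => ?_
    rw [fermionEmbed_sum]
    refine Finset.sum_congr rfl fun σ _ => ?_
    split_ifs
    · rw [fermionEmbed_mul, fermionEmbed_creation, fermionEmbed_annihilation]
    · rw [fermionEmbed_zero]
  · refine Finset.sum_congr rfl fun a _ => ?_
    rw [fermionEmbed_mul, fermionEmbed_numberOp, fermionEmbed_numberOp]

/-- A `σ`-sum of a `σ`-independent conditional. [folklore] -/
theorem sum_ite_const_cond {β : Type*} [AddCommMonoid β] (P : Prop) [Decidable P] (f : Fin 2 → β) :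
    (∑ σ : Fin 2, if P then f σ else 0) = if P then ∑ σ : Fin 2, f σ else 0 := by
  split_ifs <;> simp

/-- **Cluster decomposition of the Hubbard Hamiltonian on the torus `(ℤ/2M)²`** (`M ≥ 2`):
`H = Σ_c Γ(cellEmb c) H_plaq(t,U) + Σ_{(c,e)} Γ(linkEmb c e) T_e(t)`, with `H_plaq` the Hubbard
Hamiltonian of the plaquette 4-cycle and `T_e = hamiltonian (linkGraph e) t 0` the hopping across the
two bonds between the plaquettes `c` and `c + e`. [folklore] -/
theorem hamiltonian_eq_sum_cells_add_sum_links (hM : 2 ≤ M) (t U : ℝ) :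
    hamiltonian (fermionTorusGraph 2 (M * 2)) t U =
      ∑ c : Fin 2 → Fin M, fermionEmbed (cellEmb c) (hamiltonian plaquetteGraph t U) +
        ∑ ℓ : (Fin 2 → Fin M) × Fin 2,
          fermionEmbed (linkEmb hM ℓ.1 ℓ.2) (hamiltonian (linkGraph ℓ.2) t 0) := by
  simp_rw [fermionEmbed_hamiltonian, Complex.ofReal_zero, zero_smul, add_zero]
  rw [Finset.sum_add_distrib, ← Finset.smul_sum, ← Finset.smul_sum, ← Finset.smul_sum, hamiltonian,
    add_right_comm, ← smul_add]
  congr 2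
  · -- hopping
    simp_rw [sum_ite_const_cond]
    rw [sum_ite_adj_eq hM, Fintype.sum_prod_type]
    congr 1
    refine Finset.sum_congr rfl fun c _ => Finset.sum_congr rfl fun e _ => ?_
    rw [sum_ite_linkGraph_eq]
    simp only [linkEmb_apply, ofLex_toLex, Fin.isValue, ↓reduceIte, one_ne_zero]
  · -- on-site repulsion
    rw [sum_cellSite]
    rfl

/-! ### §5. The bound -/

set_option maxHeartbeats 800000 in
/-- **The plaquette-dressed Slater (local-unitary-cluster) bound on the torus `(ℤ/2M)²`, `M ≥ 2`.**
For all real `t, U`, every orthogonal projection `P` on the one-particle space of the torus with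
`tr P = N`, and every family of particle-number conserving unitaries `u_c` of the plaquette Fock
space (`u_cᴴ u_c = 1`, `[N̂, u_c] = 0`),
`E_{(ℤ/2M)²}(t,U;N) ≤ Re [ Σ_c Σ_{s,t} (u_cᴴ H_plaq u_c)_{st} · slaterRDM (P|_{cell c}) s t
   + Σ_{(c,e)} Σ_{s,t} (V_{c,e}ᴴ T_e V_{c,e})_{st} · slaterRDM (P|_{link c,e}) s t ]`,
`V_{c,e} = Γ(inlCell) u_c · Γ(inrCell) u_{c+e}`: the energy of the dressed Slater determinant
`(∏_c Γ(cellEmb c) u_c) Φ_P`, an explicit polynomial in the window entries of `P` and the entries of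
the `u_c`. (`DressedCluster.groundEnergy_le` + `hamiltonian_eq_sum_cells_add_sum_links`.)
[cite: BachLiebSolovej1994, eq. (2c.36)] -/
theorem groundEnergyAt_le_dressed (hM : 2 ≤ M) (t U : ℝ)
    {P : Matrix (Orb (FermionTorus 2 (M * 2))) (Orb (FermionTorus 2 (M * 2))) ℂ}
    (hP : P.IsHermitian) (hPP : P * P = P) {N : ℕ} (htr : P.trace = N)
    (u : (Fin 2 → Fin M) → Matrix (Finset (Orb (FermionTorus 2 2))) (Finset (Orb (FermionTorus 2 2))) ℂ)
    (hu : ∀ c, (u c)ᴴ * u c = 1) (huN : ∀ c, Commute totalNumberOp (u c)) :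
    groundEnergyAt (fermionTorusGraph 2 (M * 2)) t U N ≤
      ((∑ c : Fin 2 → Fin M, ∑ s : Finset (Orb (FermionTorus 2 2)), ∑ s' : Finset (Orb (FermionTorus 2 2)),
          ((u c)ᴴ * hamiltonian plaquetteGraph t U * u c) s s' *
            HartreeFock.slaterRDM (P.submatrix (fun a => orb (cellEmb c (ofLex a).1) (ofLex a).2)
              (fun a => orb (cellEmb c (ofLex a).1) (ofLex a).2)) s s') +
        ∑ ℓ : (Fin 2 → Fin M) × Fin 2, ∑ s : Finset (Orb (Fin 2 ×ₗ FermionTorus 2 2)),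
          ∑ s' : Finset (Orb (Fin 2 ×ₗ FermionTorus 2 2)),
            ((fermionEmbed inlCell (u ℓ.1) * fermionEmbed inrCell (u (shiftCell ℓ.1 ℓ.2)))ᴴ *
                hamiltonian (linkGraph ℓ.2) t 0 *
              (fermionEmbed inlCell (u ℓ.1) * fermionEmbed inrCell (u (shiftCell ℓ.1 ℓ.2)))) s s' *
            HartreeFock.slaterRDM (P.submatrix (fun a => orb (linkEmb hM ℓ.1 ℓ.2 (ofLex a).1) (ofLex a).2)
              (fun a => orb (linkEmb hM ℓ.1 ℓ.2 (ofLex a).1) (ofLex a).2)) s s').re := by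
  have hH := hamiltonian_eq_sum_cells_add_sum_links hM t U
  have h := DressedCluster.groundEnergy_le (φ := cellEmb) (hdisj := fun _ _ h => disjoint_cellEmb h)
    (u := u) (huN := huN) (ψ := fun ℓ : (Fin 2 → Fin M) × Fin 2 => linkEmb hM ℓ.1 ℓ.2)
    (src := fun ℓ => ℓ.1) (tgt := fun ℓ => shiftCell ℓ.1 ℓ.2) (ι₁ := inlCell) (ι₂ := inrCell)
    (hne := fun ℓ => (shiftCell_ne hM ℓ.1 ℓ.2).symm) (hsrc := fun ℓ => inlCell_trans_linkEmb hM ℓ.1 ℓ.2)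
    (htgt := fun ℓ => inrCell_trans_linkEmb hM ℓ.1 ℓ.2) (hcover := mem_range_inlCell_or_inrCell)
    hP hPP htr (hu := fun c => by convert hu c) (H := hamiltonian (fermionTorusGraph 2 (M * 2)) t U)
    (h₁ := fun _ => hamiltonian plaquetteGraph t U) (h₂ := fun ℓ => hamiltonian (linkGraph ℓ.2) t 0) hH
  rw [groundEnergyAt]
  convert h using 3

end PlaquetteLUC

end Literature.MathematicalPhysics.QuantumLattice
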